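import Literature.MathematicalPhysics.QuantumManyBody.BoseGasPairCollisionCutoff
import Literature.Analysis.Calculus.SmoothCutoff
import Mathlib.Analysis.InnerProductSpace.Calculus
import HarnessLib

/-!
# Crux `GroundStateRigidity` (stmt-AtomisticToContinuum-9072), line `Sketch`:
# the registered stub `stub_coreCutoff`

Supports (does not close) stmt-AtomisticToContinuum-9072; registered stub `stub_coreCutoff`
(Stub 15a) of line Sketch (lead c4). **`C¹` symmetric pair cutoffs at arbitrary radii
`0 < r₁ < r₂` with the natural gradient bound `A(N)/(r₂ - r₁)²`.** The cutoff is
`χ(X) = θ(∑_{i ≠ j} g(xᵢ - xⱼ))` with the smooth step `θ = 1 - smoothTransition` (`1` on `(-∞,0]`,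
`0` on `[1,∞)`, values in `[0,1]`) and the radial profile
`g(y) = smoothTransition ((r₂² - |y|²)/(r₂² - r₁²))` (smooth since `|y|²` is; `= 1` for
`|y| ≤ r₁`, `= 0` for `|y| ≥ r₂`). With `K = sup |smoothTransition'|` (a universal constant; the
derivative vanishes off `[0,1]`: `Literature/Analysis/Calculus/SmoothCutoff.lean`) one has
`|θ'| ≤ K`, `‖Dg(y)‖ ≤ K · 2|y|/(r₂² - r₁²) ≤ 2K/(r₂ - r₁)` for `|y| < r₂` and `Dg(y) = 0` for
`|y| ≤ r₁` or `|y| ≥ r₂`; hence (chain rule over the `N²` ordered pairs, `‖prᵢ - prⱼ‖ ≤ 2`)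
`‖Dχ‖ ≤ K · N² · (2K/(r₂ - r₁)) · 2 = C(N)/(r₂ - r₁)`, `|∇χ|² ≤ 3N ‖Dχ‖² = A(N)/(r₂ - r₁)²`, and
`Dχ(X) = 0` unless some pair distance lies in the open interval `(r₁, r₂)`. The pair-sum calculus
is adapted from `Literature/…/BoseGasPairCollisionCutoff.lean` (there for scaled bumps).
-/

noncomputable section

open MeasureTheory Filter Set Metric
open scoped ENNReal NNReal Topology

namespace Summit.AtomisticToContinuum.BoseEinsteinCondensation.Theorems.GroundStateRigidity

open Literature.MathematicalPhysics.QuantumManyBody.BoseGas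
open Literature.Analysis.Calculus (differentiable_smoothTransition deriv_smoothTransition_of_nonpos
  deriv_smoothTransition_of_one_le exists_bound_deriv_smoothTransition)
open ContinuousLinearMap (proj)

namespace CoreCutoff

variable {N : ℕ}

/-! ### The radial profile `g(y) = smoothTransition ((r₂² - |y|²)/(r₂² - r₁²))` -/

/-- The radial profile is `C¹` (indeed smooth: `|y|²` is). [folklore] -/
theorem step_contDiff (r₁ r₂ : ℝ) :
    ContDiff ℝ 1 fun y : Space =>
      Real.smoothTransition ((r₂ ^ 2 - ‖y‖ ^ 2) / (r₂ ^ 2 - r₁ ^ 2)) :=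
  Real.smoothTransition.contDiff.comp ((contDiff_const.sub (contDiff_norm_sq ℝ)).div_const _)

/-- The radial profile equals `1` on the closed ball of radius `r₁`. [folklore] -/
theorem step_eq_one {r₁ r₂ : ℝ} (hr₁ : 0 < r₁) (hr₁₂ : r₁ < r₂) {y : Space} (hy : ‖y‖ ≤ r₁) :
    Real.smoothTransition ((r₂ ^ 2 - ‖y‖ ^ 2) / (r₂ ^ 2 - r₁ ^ 2)) = 1 := by
  have hc : 0 < r₂ ^ 2 - r₁ ^ 2 := by nlinarith
  refine Real.smoothTransition.one_of_one_le ((one_le_div hc).2 ?_)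
  nlinarith [norm_nonneg y, pow_le_pow_left₀ (norm_nonneg y) hy 2]

/-- The radial profile vanishes off the open ball of radius `r₂`. [folklore] -/
theorem step_eq_zero {r₁ r₂ : ℝ} (hr₁ : 0 < r₁) (hr₁₂ : r₁ < r₂) {y : Space} (hy : r₂ ≤ ‖y‖) :
    Real.smoothTransition ((r₂ ^ 2 - ‖y‖ ^ 2) / (r₂ ^ 2 - r₁ ^ 2)) = 0 := by
  have hc : 0 < r₂ ^ 2 - r₁ ^ 2 := by nlinarith
  refine Real.smoothTransition.zero_of_nonpos (div_nonpos_of_nonpos_of_nonneg ?_ hc.le)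
  nlinarith [pow_le_pow_left₀ (by linarith : (0 : ℝ) ≤ r₂) hy 2]

/-- Chain rule for the radial profile:
`Dg(y) = (smoothTransition'(u(y)) · (-1/(r₂² - r₁²))) • D|·|²(y)`. [folklore] -/
theorem hasFDerivAt_step (r₁ r₂ : ℝ) (y : Space) :
    HasFDerivAt (fun z : Space => Real.smoothTransition ((r₂ ^ 2 - ‖z‖ ^ 2) / (r₂ ^ 2 - r₁ ^ 2)))
      ((deriv Real.smoothTransition ((r₂ ^ 2 - ‖y‖ ^ 2) / (r₂ ^ 2 - r₁ ^ 2)) *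
          (-1 / (r₂ ^ 2 - r₁ ^ 2))) • (2 • innerSL ℝ y)) y := by
  have h1 : HasDerivAt (fun t : ℝ => (r₂ ^ 2 - t) / (r₂ ^ 2 - r₁ ^ 2)) (-1 / (r₂ ^ 2 - r₁ ^ 2))
      (‖y‖ ^ 2) :=
    ((hasDerivAt_id' (‖y‖ ^ 2)).const_sub (r₂ ^ 2)).div_const _
  have h2 : HasDerivAt
      (fun t : ℝ => Real.smoothTransition ((r₂ ^ 2 - t) / (r₂ ^ 2 - r₁ ^ 2)))
      (deriv Real.smoothTransition ((r₂ ^ 2 - ‖y‖ ^ 2) / (r₂ ^ 2 - r₁ ^ 2)) *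
        (-1 / (r₂ ^ 2 - r₁ ^ 2))) (‖y‖ ^ 2) :=
    (differentiable_smoothTransition _).hasDerivAt.comp (‖y‖ ^ 2) h1
  exact h2.comp_hasFDerivAt y (hasStrictFDerivAt_norm_sq y).hasFDerivAt

/-- The derivative of the radial profile vanishes for `|y| ≤ r₁` and for `|y| ≥ r₂`. [folklore] -/
theorem fderiv_step_eq_zero {r₁ r₂ : ℝ} (hr₁ : 0 < r₁) (hr₁₂ : r₁ < r₂) {y : Space}
    (hy : ‖y‖ ≤ r₁ ∨ r₂ ≤ ‖y‖) :
    fderiv ℝ (fun z : Space =>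
      Real.smoothTransition ((r₂ ^ 2 - ‖z‖ ^ 2) / (r₂ ^ 2 - r₁ ^ 2))) y = 0 := by
  rw [(hasFDerivAt_step r₁ r₂ y).fderiv]
  have hc : 0 < r₂ ^ 2 - r₁ ^ 2 := by nlinarith
  have h0 : deriv Real.smoothTransition ((r₂ ^ 2 - ‖y‖ ^ 2) / (r₂ ^ 2 - r₁ ^ 2)) = 0 := by
    rcases hy with hy | hy
    · refine deriv_smoothTransition_of_one_le ((one_le_div hc).2 ?_)
      nlinarith [norm_nonneg y, pow_le_pow_left₀ (norm_nonneg y) hy 2]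
    · refine deriv_smoothTransition_of_nonpos (div_nonpos_of_nonpos_of_nonneg ?_ hc.le)
      nlinarith [pow_le_pow_left₀ (by linarith : (0 : ℝ) ≤ r₂) hy 2]
  rw [h0, zero_mul, zero_smul]

/-- **Gradient bound for the radial profile**: `‖Dg(y)‖ ≤ 2K/(r₂ - r₁)` (`= 0` for `|y| ≥ r₂`;
otherwise `≤ K · 2|y|/(r₂² - r₁²) ≤ 2K r₂/((r₂ - r₁)(r₂ + r₁))`). [folklore] -/
theorem norm_fderiv_step_le {r₁ r₂ K : ℝ} (hr₁ : 0 < r₁) (hr₁₂ : r₁ < r₂) (hK0 : 0 ≤ K)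
    (hK : ∀ t, |deriv Real.smoothTransition t| ≤ K) (y : Space) :
    ‖fderiv ℝ (fun z : Space =>
        Real.smoothTransition ((r₂ ^ 2 - ‖z‖ ^ 2) / (r₂ ^ 2 - r₁ ^ 2))) y‖ ≤
      2 * K / (r₂ - r₁) := by
  have hr : 0 < r₂ - r₁ := sub_pos.2 hr₁₂
  rcases le_or_gt r₂ ‖y‖ with hy | hy
  · rw [fderiv_step_eq_zero hr₁ hr₁₂ (Or.inr hy), norm_zero]
    positivity
  · have hc : 0 < r₂ ^ 2 - r₁ ^ 2 := by nlinarith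
    rw [(hasFDerivAt_step r₁ r₂ y).fderiv, norm_smul]
    have ha : ‖deriv Real.smoothTransition ((r₂ ^ 2 - ‖y‖ ^ 2) / (r₂ ^ 2 - r₁ ^ 2)) *
        (-1 / (r₂ ^ 2 - r₁ ^ 2))‖ ≤ K / (r₂ ^ 2 - r₁ ^ 2) := by
      rw [norm_mul, norm_div, norm_neg, norm_one, Real.norm_of_nonneg hc.le, mul_one_div,
        Real.norm_eq_abs]
      exact div_le_div_of_nonneg_right (hK _) hc.le
    have hb : ‖(2 • innerSL ℝ y : Space →L[ℝ] ℝ)‖ ≤ 2 * r₂ := by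
      refine norm_nsmul_le.trans ?_
      rw [innerSL_apply_norm]
      push_cast
      linarith
    refine (mul_le_mul ha hb (norm_nonneg _) (by positivity)).trans ?_
    rw [div_mul_eq_mul_div, div_le_div_iff₀ hc hr]
    nlinarith [mul_nonneg (mul_nonneg hK0 hr₁.le) hr.le]

/-! ### The pair sum `s(X) = ∑_{i ≠ j} g(xᵢ - xⱼ)` for a profile `g` (adapted from
`BoseGas.PairCutoff`, where `g` is a scaled bump) -/

/-- Each pair term lies in `[0, 1]`. [folklore] -/
theorem pairTerm_mem {g : Space → ℝ} (hg : ∀ y, 0 ≤ g y ∧ g y ≤ 1) (i j : Fin N) (X : Config N) :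
    0 ≤ (if i = j then (0 : ℝ) else g (X i - X j)) ∧
      (if i = j then (0 : ℝ) else g (X i - X j)) ≤ 1 := by
  split_ifs
  · exact ⟨le_rfl, zero_le_one⟩
  · exact hg _

/-- The pair sum is symmetric under permutations of the particles. [folklore] -/
theorem pairSum_comp_perm (g : Space → ℝ) (σ : Equiv.Perm (Fin N)) (X : Config N) :
    (∑ i, ∑ j, if i = j then (0 : ℝ) else g (X (σ i) - X (σ j))) =
      ∑ i, ∑ j, if i = j then (0 : ℝ) else g (X i - X j) := by
  -- adapted from `PairCutoff.pairSum_comp_perm`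
  set F : Fin N → Fin N → ℝ := fun a b => if a = b then 0 else g (X a - X b) with hF
  have h1 : ∀ i j, (if i = j then (0 : ℝ) else g (X (σ i) - X (σ j))) = F (σ i) (σ j) :=
    fun i j => by simp only [hF, σ.injective.eq_iff]
  simp_rw [h1]
  calc ∑ i, ∑ j, F (σ i) (σ j) = ∑ a, ∑ j, F a (σ j) :=
        Fintype.sum_equiv σ _ _ fun i => rfl
    _ = ∑ a, ∑ b, F a b :=
        Finset.sum_congr rfl fun a _ => Fintype.sum_equiv σ _ _ fun j => rfl

/-- The pair sum is `≥ 1` as soon as some pair term equals `1`. [folklore] -/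
theorem one_le_pairSum {g : Space → ℝ} (hg : ∀ y, 0 ≤ g y ∧ g y ≤ 1) {X : Config N}
    (h : ∃ i j : Fin N, i ≠ j ∧ g (X i - X j) = 1) :
    1 ≤ ∑ i, ∑ j, if i = j then (0 : ℝ) else g (X i - X j) := by
  -- adapted from `PairCutoff.one_le_pairSum`
  obtain ⟨i, j, hij, hd⟩ := h
  have hterm : (if i = j then (0 : ℝ) else g (X i - X j)) = 1 := by rw [if_neg hij, hd]
  calc (1 : ℝ) = (if i = j then (0 : ℝ) else g (X i - X j)) := hterm.symm
    _ ≤ ∑ j', if i = j' then (0 : ℝ) else g (X i - X j') :=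
        Finset.single_le_sum (fun j' _ => (pairTerm_mem hg i j' X).1) (Finset.mem_univ j)
    _ ≤ ∑ i', ∑ j', if i' = j' then (0 : ℝ) else g (X i' - X j') :=
        Finset.single_le_sum
          (fun i' _ => Finset.sum_nonneg fun j' _ => (pairTerm_mem hg i' j' X).1)
          (Finset.mem_univ i)

/-- The pair sum vanishes when all pair terms do. [folklore] -/
theorem pairSum_eq_zero {g : Space → ℝ} {X : Config N}
    (h : ∀ i j : Fin N, i ≠ j → g (X i - X j) = 0) :
    (∑ i, ∑ j, if i = j then (0 : ℝ) else g (X i - X j)) = 0 := by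
  refine Finset.sum_eq_zero fun i _ => Finset.sum_eq_zero fun j _ => ?_
  split_ifs with hij
  · rfl
  · exact h i j hij

/-! ### The cutoff `θ ∘ s` and its derivative -/

/-- The cutoff `θ ∘ s` is `C¹` for `C¹` profiles `θ`, `g`. [folklore] -/
theorem cutoff_contDiff {θ : ℝ → ℝ} (hθ : ContDiff ℝ 1 θ) {g : Space → ℝ} (hg : ContDiff ℝ 1 g) :
    ContDiff ℝ 1 fun Y : Config N =>
      θ (∑ i, ∑ j, if i = j then (0 : ℝ) else g (Y i - Y j)) := by
  refine hθ.comp (ContDiff.sum fun i _ => ContDiff.sum fun j _ => ?_)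
  by_cases h : i = j
  · simp only [h, if_true]
    exact contDiff_const
  · simp only [h, if_false]
    exact hg.comp ((contDiff_apply ℝ Space i).sub (contDiff_apply ℝ Space j))

/-- `‖prᵢ - prⱼ‖ ≤ 2`. [folklore] -/
theorem norm_projDiff_le (i j : Fin N) :
    ‖((proj i : Config N →L[ℝ] Space) - proj j)‖ ≤ 2 := by
  refine ContinuousLinearMap.opNorm_le_bound _ zero_le_two fun v => ?_
  show ‖v i - v j‖ ≤ 2 * ‖v‖
  have h1 := norm_le_pi_norm v i
  have h2 := norm_le_pi_norm v j
  have h3 : ‖v i - v j‖ ≤ ‖v i‖ + ‖v j‖ := norm_sub_le _ _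
  linarith

/-- Chain rule for one pair term. [folklore] -/
theorem hasFDerivAt_pairTerm {g : Space → ℝ} (hg : Differentiable ℝ g) (i j : Fin N)
    (X : Config N) :
    HasFDerivAt (fun Y : Config N => if i = j then (0 : ℝ) else g (Y i - Y j))
      (if i = j then (0 : Config N →L[ℝ] ℝ) else
        (fderiv ℝ g (X i - X j)).comp ((proj i : Config N →L[ℝ] Space) - proj j)) X := by
  by_cases h : i = j
  · simp only [h, if_true]
    exact hasFDerivAt_const 0 X
  · simp only [h, if_false]
    exact (hg _).hasFDerivAt.comp X ((hasFDerivAt_apply i X).sub (hasFDerivAt_apply j X))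

/-- Chain rule for the cutoff: `D(θ ∘ s)(X) = θ'(s X) • Ds(X)`. [folklore] -/
theorem hasFDerivAt_cutoff {θ : ℝ → ℝ} (hθ : Differentiable ℝ θ) {g : Space → ℝ}
    (hg : Differentiable ℝ g) (X : Config N) :
    HasFDerivAt (fun Y : Config N => θ (∑ i, ∑ j, if i = j then (0 : ℝ) else g (Y i - Y j)))
      (deriv θ (∑ i, ∑ j, if i = j then (0 : ℝ) else g (X i - X j)) •
        ∑ i, ∑ j, if i = j then (0 : Config N →L[ℝ] ℝ) else
          (fderiv ℝ g (X i - X j)).comp ((proj i : Config N →L[ℝ] Space) - proj j)) X :=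
  (hθ _).hasDerivAt.comp_hasFDerivAt X
    (HasFDerivAt.fun_sum fun i _ => HasFDerivAt.fun_sum fun j _ => hasFDerivAt_pairTerm hg i j X)

/-- **Uniform gradient bound** `‖D(θ ∘ s)(X)‖ ≤ K · N² · M · 2` from `|θ'| ≤ K` and `‖Dg‖ ≤ M`.
[folklore] -/
theorem norm_fderiv_cutoff_le {θ : ℝ → ℝ} (hθ : Differentiable ℝ θ) {K : ℝ} (hK0 : 0 ≤ K)
    (hK : ∀ t, ‖deriv θ t‖ ≤ K) {g : Space → ℝ} (hg : Differentiable ℝ g) {M : ℝ}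
    (hM0 : 0 ≤ M) (hM : ∀ y, ‖fderiv ℝ g y‖ ≤ M) (X : Config N) :
    ‖fderiv ℝ (fun Y : Config N =>
        θ (∑ i, ∑ j, if i = j then (0 : ℝ) else g (Y i - Y j))) X‖ ≤
      K * ((N : ℝ) * N * (M * 2)) := by
  -- adapted from `PairCutoff.norm_fderiv_cutoff_le`
  rw [(hasFDerivAt_cutoff hθ hg X).fderiv, norm_smul]
  set D : Fin N → Fin N → Config N →L[ℝ] ℝ := fun i j => if i = j then 0 else
    (fderiv ℝ g (X i - X j)).comp ((proj i : Config N →L[ℝ] Space) - proj j) with hD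
  have hDle : ∀ i j, ‖D i j‖ ≤ M * 2 := by
    intro i j
    simp only [hD]
    split_ifs
    · rw [norm_zero]
      positivity
    · exact (ContinuousLinearMap.opNorm_comp_le _ _).trans
        (mul_le_mul (hM _) (norm_projDiff_le i j) (norm_nonneg _) hM0)
  have h2 : ‖∑ i, ∑ j, D i j‖ ≤ (N : ℝ) * N * (M * 2) := by
    calc ‖∑ i, ∑ j, D i j‖ ≤ ∑ i, ‖∑ j, D i j‖ := norm_sum_le _ _
      _ ≤ ∑ i, ∑ j, ‖D i j‖ := Finset.sum_le_sum fun i _ => norm_sum_le _ _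
      _ ≤ ∑ _i : Fin N, ∑ _j : Fin N, M * 2 :=
          Finset.sum_le_sum fun i _ => Finset.sum_le_sum fun j _ => hDle i j
      _ = (N : ℝ) * N * (M * 2) := by
          simp only [Finset.sum_const, Finset.card_univ, Fintype.card_fin, nsmul_eq_mul]
          ring
  exact mul_le_mul (hK _) h2 (norm_nonneg _) hK0

/-- The derivative of the cutoff vanishes where all the pair derivatives `Dg(xᵢ - xⱼ)` do.
[folklore] -/
theorem fderiv_cutoff_eq_zero {θ : ℝ → ℝ} (hθ : Differentiable ℝ θ) {g : Space → ℝ}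
    (hg : Differentiable ℝ g) {X : Config N}
    (h : ∀ i j : Fin N, i ≠ j → fderiv ℝ g (X i - X j) = 0) :
    fderiv ℝ (fun Y : Config N =>
        θ (∑ i, ∑ j, if i = j then (0 : ℝ) else g (Y i - Y j))) X = 0 := by
  -- adapted from `PairCutoff.fderiv_cutoff_eq_zero`
  rw [(hasFDerivAt_cutoff hθ hg X).fderiv]
  have hD : ∀ i j : Fin N, (if i = j then (0 : Config N →L[ℝ] ℝ) else
      (fderiv ℝ g (X i - X j)).comp ((proj i : Config N →L[ℝ] Space) - proj j)) = 0 := by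
    intro i j
    split_ifs with hij
    · rfl
    · rw [h i j hij, ContinuousLinearMap.zero_comp]
  simp only [hD, Finset.sum_const_zero, smul_zero]

end CoreCutoff

/-! ### The stub -/

open CoreCutoff in
/-- **Stub `stub_coreCutoff` (15a) of line `Sketch` — `C¹` symmetric pair cutoffs with the natural
gradient bound.** For every `N` there is `A = A(N)` such that for all `0 < r₁ < r₂` some `C¹`
function `χ : (ℝ³)^N → [0,1]`, symmetric under permutations of the particles, vanishes where some
pair is at distance `≤ r₁`, equals `1` where all pairs are at distance `≥ r₂`, and has
`|∇χ|² ≤ A/(r₂ − r₁)²`, supported where some pair distance lies in `(r₁, r₂)`: take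
`χ = θ(∑_{i ≠ j} g(xᵢ - xⱼ))`, `θ = 1 - smoothTransition`,
`g(y) = smoothTransition ((r₂² - |y|²)/(r₂² - r₁²))`, and `A = 3N C²`,
`C = K · N² · 2K · 2`, `K = sup |smoothTransition'|`. [cite: LSSY2005, proof of Thm 2.4] -/
theorem stub_coreCutoff :
    ∀ (N : ℕ), ∃ A : ℝ≥0, ∀ r₁ r₂ : ℝ, 0 < r₁ → r₁ < r₂ →
      ∃ χ : Config N → ℝ, ContDiff ℝ 1 χ ∧ (∀ X, 0 ≤ χ X ∧ χ X ≤ 1) ∧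
        (∀ (σ : Equiv.Perm (Fin N)) (X : Config N), χ (X ∘ σ) = χ X) ∧
        (∀ X : Config N, (∃ i j : Fin N, i ≠ j ∧ dist (X i) (X j) ≤ r₁) → χ X = 0) ∧
        (∀ X : Config N, (∀ i j : Fin N, i ≠ j → r₂ ≤ dist (X i) (X j)) → χ X = 1) ∧
        (∀ X : Config N, realKinetic χ X ≤
          {Y : Config N | ∃ i j : Fin N, i ≠ j ∧ r₁ < dist (Y i) (Y j) ∧
              dist (Y i) (Y j) < r₂}.indicator
            (fun _ => ENNReal.ofReal ((A : ℝ) / (r₂ - r₁) ^ 2)) X) := by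
  intro N
  -- the universal bound `K` on `|smoothTransition'|` and the profile `θ = 1 - smoothTransition`
  obtain ⟨K, hK0, hK⟩ := exists_bound_deriv_smoothTransition
  set θ : ℝ → ℝ := fun t => 1 - Real.smoothTransition t with hθ
  have hθC : ContDiff ℝ 1 θ := contDiff_const.sub Real.smoothTransition.contDiff
  have hθd : Differentiable ℝ θ := hθC.differentiable one_ne_zero
  have hθ0 : θ 0 = 1 := by simp [hθ, Real.smoothTransition.zero_of_nonpos le_rfl]
  have hθ1 : ∀ t, 1 ≤ t → θ t = 0 := fun t ht => by
    simp [hθ, Real.smoothTransition.one_of_one_le ht]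
  have hθm : ∀ t, 0 ≤ θ t ∧ θ t ≤ 1 := fun t =>
    ⟨sub_nonneg.2 (Real.smoothTransition.le_one t), sub_le_self _ (Real.smoothTransition.nonneg t)⟩
  have hθK : ∀ t, ‖deriv θ t‖ ≤ K := fun t => by
    rw [hθ, deriv_const_sub, norm_neg, Real.norm_eq_abs]
    exact hK t
  -- the constants
  set C : ℝ := K * ((N : ℝ) * N * (2 * K * 2)) with hC
  set Q : ℝ := 3 * N * C ^ 2 with hQ
  have hQ0 : 0 ≤ Q := by positivity
  refine ⟨Q.toNNReal, fun r₁ r₂ hr₁ hr₁₂ => ?_⟩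
  have hr : 0 < r₂ - r₁ := sub_pos.2 hr₁₂
  -- the radial profile `g`
  set g : Space → ℝ :=
    fun y => Real.smoothTransition ((r₂ ^ 2 - ‖y‖ ^ 2) / (r₂ ^ 2 - r₁ ^ 2)) with hg
  have hgC : ContDiff ℝ 1 g := step_contDiff r₁ r₂
  have hgd : Differentiable ℝ g := hgC.differentiable one_ne_zero
  have hg01 : ∀ y, 0 ≤ g y ∧ g y ≤ 1 := fun y =>
    ⟨Real.smoothTransition.nonneg _, Real.smoothTransition.le_one _⟩
  have hgM : ∀ y, ‖fderiv ℝ g y‖ ≤ 2 * K / (r₂ - r₁) := fun y =>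
    norm_fderiv_step_le hr₁ hr₁₂ hK0 hK y
  -- the exceptional layer `U = {some pair distance in (r₁, r₂)}`
  set U : Set (Config N) :=
    {Y : Config N | ∃ i j : Fin N, i ≠ j ∧ r₁ < dist (Y i) (Y j) ∧ dist (Y i) (Y j) < r₂} with hU
  -- the cutoff `χ = θ ∘ s`
  set χ : Config N → ℝ :=
    fun X => θ (∑ i, ∑ j, if i = j then (0 : ℝ) else g (X i - X j)) with hχ
  have hDle : ∀ X, ‖fderiv ℝ χ X‖ ≤ C / (r₂ - r₁) := fun X => by
    refine (norm_fderiv_cutoff_le hθd hK0 hθK hgd (by positivity) hgM X).trans (le_of_eq ?_)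
    rw [hC]
    ring
  have hD0 : ∀ X, X ∉ U → fderiv ℝ χ X = 0 := fun X hX => by
    refine fderiv_cutoff_eq_zero hθd hgd fun i j hij => fderiv_step_eq_zero hr₁ hr₁₂ ?_
    rw [← dist_eq_norm]
    by_contra hcon
    refine hX ⟨i, j, hij, ?_, ?_⟩
    · exact not_le.1 fun h' => hcon (Or.inl h')
    · exact not_le.1 fun h' => hcon (Or.inr h')
  refine ⟨χ, cutoff_contDiff hθC hgC, fun X => hθm _, fun σ X => ?_, fun X hX => ?_,
    fun X hX => ?_, fun X => ?_⟩
  · -- symmetry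
    simp only [hχ, Function.comp_apply]
    rw [pairSum_comp_perm g σ X]
  · -- vanishing where some pair is `r₁`-close
    obtain ⟨i, j, hij, hd⟩ := hX
    have h1 : g (X i - X j) = 1 := step_eq_one hr₁ hr₁₂ (by rwa [← dist_eq_norm])
    exact hθ1 _ (one_le_pairSum hg01 ⟨i, j, hij, h1⟩)
  · -- plateau `1` where all pairs are `r₂`-separated
    have h0 : ∀ i j : Fin N, i ≠ j → g (X i - X j) = 0 := fun i j hij =>
      step_eq_zero hr₁ hr₁₂ (by rw [← dist_eq_norm]; exact hX i j hij)
    simp only [hχ]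
    rw [pairSum_eq_zero h0, hθ0]
  · -- the gradient bound, supported in the layer `U`
    by_cases hXU : X ∈ U
    · rw [Set.indicator_of_mem hXU, Real.coe_toNNReal Q hQ0]
      refine (PairCutoff.realKinetic_le_of_norm_fderiv_le (hDle X)).trans (le_of_eq ?_)
      rw [hQ, div_pow]
      congr 1
      ring
    · rw [Set.indicator_of_notMem hXU, PairCutoff.realKinetic_eq_zero_of_fderiv (hD0 X hXU)]

end Summit.AtomisticToContinuum.BoseEinsteinCondensation.Theorems.GroundStateRigidity

end
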